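import Summits.RiemannHypothesis.RiemannHypothesis.Theses.WeilComb
import Summits.RiemannHypothesis.RiemannHypothesis.Theorems.WeilCombCombShapePositivityExactPrimeWindow
import Summits.RiemannHypothesis.RiemannHypothesis.Theorems.WeilCombCombShapePositivityPolarExact
import Summits.RiemannHypothesis.RiemannHypothesis.Theorems.WeilCombCombShapePositivityStubWindowMellin
import Summits.RiemannHypothesis.RiemannHypothesis.Theorems.WeilCombCombShapePositivityStubWindowNorm
import Summits.RiemannHypothesis.RiemannHypothesis.Theorems.CombShapePositivity.Negative.WeilCombCombShapePositivityLoadBearing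
import Literature.NumberTheory.LFunctions.WeilExplicit
import Literature.NumberTheory.LFunctions.WeilArchimedeanMoments
import Literature.NumberTheory.LFunctions.WeilArchimedeanPositivityProofs
import Literature.NumberTheory.LFunctions.WeilGroundEnergyProofs

/-!
# `stub_windowCore` reduced to the landed sub-goals: normal form, monotonicity in the level, top cells
(crux `WeilComb.CombShapePositivity`, item stmt-RiemannHypothesis-11229, line `Sketch`, skeleton v7 `86d35e56a923`)

Notation. `φ₀(u) = expNegInvGlue (1 - u²)`, `φ_ε(t) = ε⁻¹ φ₀(t/ε)`, comb `g = Σ_{m ≤ M} a_m φ_ε(· − log m)`,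
`Q(g) = weilQuadratic g = W(g ⋆ g̃)`, `N = ‖φ₀‖₂²`, `L = Σ ‖a_m‖²`, Helson form
`H(a) = 2 Re Σ_m Σ_{n ≤ M/m} Λ(n) n^{-1/2} a(nm) conj a(m)`, `A₋ = Σ a_m m^{-1/2}`, `A₊ = Σ a_m m^{1/2}`,
`D_a(t) = Σ a_m m^{it}`, `P = 2 Re(φ̂_ε(0) conj φ̂_ε(1) · A₋ conj A₊)`,
`J = ∫ |φ̂_ε(1/2+it)|² |D_a(t)|² Re ψ(1/4 + it/2) dt`.

The registered stub `stub_windowCore` of skeleton v7 is THEOREM B of the route (exact-window comb positivity) on the band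
`1/40 < εM`, `2ε(M+1) ≤ 1`, written in the signed normal form `ε⁻¹N (H + log π · L) ≤ P + J/2π`.  This file assembles
the landed sub-goals of the line into the following kernel-checked reductions (no new analysis):

* `weilQuadratic_comb_re_window_normalForm` — on every window cell (`M ≥ 1`, `2ε(M+1) ≤ 1`):
  `Re Q(g) = P + J/2π − ε⁻¹N (H + log π · L)` (exact window identity p90904 `weilQuadratic_comb_re_exactWindow`, polar
  identity p91841 `weilPolarTerm_comb_re`, W1 = `stub_windowMellin` p96387, W2 = `stub_windowNorm` p96510,
  `weilArchIntegral_weilConv_weilReflect`, `weilConv_weilReflect_apply_zero`); hence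
  `window_normalForm_iff_nonneg`: the normal-form inequality at `(ε, M, a)` is literally `0 ≤ Re Q(g)`.
* `window_of_topCells` — level monotonicity (zero-extension of the coefficients, `weilComb_shapeComb_extend`): Theorem B on
  the whole window follows from its TOP CELLS `M = ⌊1/(2ε)⌋ − 1`, i.e. the cells with `1 < 2ε(M+2)`, all of which lie on
  the curve `1/2 − 2ε < εM ≤ 1/2 − ε`.
* `window_iff_stub_windowCore`, `stub_windowCore_iff_topCells` — consequently the residual stub is EQUIVALENT to the whole of
  Theorem B (`∀ ε > 0, M, a, 2ε(M+1) ≤ 1 → 0 ≤ Re Q(g)`; the effective windows `εM ≤ 1/128`, `εM ≤ 1/40` are corollaries of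
  it, not complements) and to positivity on the top cells alone: the entire content sits at `εM → 1/2`.
* Calibration (the stub is RH-implied) is `stub_windowCore_of_riemannHypothesis` of the sibling file
  `…StubWindowCoreCells.lean` (same namespace; the copy first landed here was removed to keep the name unique in the
  tree) and `stub_windowCore_of_weilPositivity` of the companion file `…WindowCoreConeK11.lean`, which also holds the
  cone form of the top-cell reduction (rank-two dichotomy p101483).

What is NOT here: an unconditional proof of the stub (it needs the prime-sum / archimedean constants of the exact window
to absolute precision ≈ 1.4·10⁻² uniformly in `M` at `εM → 1/2`, Disproof N4b; none of the landed sub-goals supplies them).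
-/

noncomputable section

-- the sub-problem path `RiemannHypothesis/RiemannHypothesis` (single-conjunct summit, D-0017) duplicates a namespace
set_option linter.dupNamespace false

open scoped BigOperators ComplexConjugate
open Complex MeasureTheory

namespace Summit.RiemannHypothesis.RiemannHypothesis.Theorems.WeilCombBohrFejer

open Literature.NumberTheory.LFunctions

/-! ## The normal form of `Re Q(g)` on a window cell -/

/-- **Signed normal form of the comb form on the exact window.** For `0 < ε`, `1 ≤ M`, `2ε(M+1) ≤ 1`:
`Re Q(g) = 2 Re(φ̂_ε(0) conj φ̂_ε(1) · A₋ conj A₊) + (1/2π) ∫ |φ̂_ε(1/2+it)|² |D_a(t)|² Re ψ(1/4+it/2) dt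
 − ε⁻¹‖φ₀‖₂² (H(a) + log π · Σ‖a_m‖²)`
(exact window identity, polar identity, `Re W_∞(k) = (1/2π)∫|ĝ|² Re ψ − ‖g‖₂² log π`, `|ĝ|² = |φ̂_ε|²|D_a|²`,
`‖g‖₂² = ε⁻¹‖φ₀‖₂²‖a‖²`). [folklore] -/
theorem weilQuadratic_comb_re_window_normalForm : ∀ ε : ℝ, 0 < ε → ∀ (M : ℕ) (a : ℕ → ℂ), 1 ≤ M →
    2 * ε * ((M : ℝ) + 1) ≤ 1 →
    (weilQuadratic (fun x : ℝ => ∑ m ∈ Finset.Icc 1 M,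
        a m * ((ε : ℂ)⁻¹ * ((expNegInvGlue (1 - ((x - Real.log (m : ℝ)) / ε) ^ 2) : ℝ) : ℂ)))).re =
      2 * (weilMellin (fun t : ℝ => (ε : ℂ)⁻¹ * ((expNegInvGlue (1 - (t / ε) ^ 2) : ℝ) : ℂ)) 0 *
            conj (weilMellin (fun t : ℝ => (ε : ℂ)⁻¹ * ((expNegInvGlue (1 - (t / ε) ^ 2) : ℝ) : ℂ)) 1) *
          ((∑ m ∈ Finset.Icc 1 M, a m * ((Real.sqrt (m : ℝ) : ℝ) : ℂ)⁻¹) *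
            conj (∑ m ∈ Finset.Icc 1 M, a m * ((Real.sqrt (m : ℝ) : ℝ) : ℂ)))).re
      + 1 / (2 * Real.pi) * (∫ t : ℝ,
          ‖weilMellin (fun t : ℝ => (ε : ℂ)⁻¹ * ((expNegInvGlue (1 - (t / ε) ^ 2) : ℝ) : ℂ))
              (1 / 2 + t * I)‖ ^ 2 *
            ‖∑ m ∈ Finset.Icc 1 M, a m * cexp (t * I * (Real.log (m : ℝ) : ℂ))‖ ^ 2 *
            (Complex.digamma (1 / 4 + t / 2 * I)).re)
      - ε⁻¹ * weilNorm2Sq (fun u : ℝ => ((expNegInvGlue (1 - u ^ 2) : ℝ) : ℂ)) *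
        (2 * (∑ m ∈ Finset.Icc 1 M, ∑ n ∈ Finset.Icc 1 (M / m),
            ((ArithmeticFunction.vonMangoldt n : ℝ) : ℂ) / (Real.sqrt n : ℂ) * a (n * m) *
              conj (a m)).re
          + Real.log Real.pi * ∑ m ∈ Finset.Icc 1 M, ‖a m‖ ^ 2) := by
  intro ε hε M a hM hw
  -- names
  set g : ℝ → ℂ := fun x : ℝ => ∑ m ∈ Finset.Icc 1 M,
      a m * ((ε : ℂ)⁻¹ * ((expNegInvGlue (1 - ((x - Real.log (m : ℝ)) / ε) ^ 2) : ℝ) : ℂ)) with hg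
  set φε : ℝ → ℂ := fun t : ℝ => (ε : ℂ)⁻¹ * ((expNegInvGlue (1 - (t / ε) ^ 2) : ℝ) : ℂ) with hφε
  set N : ℝ := weilNorm2Sq (fun u : ℝ => ((expNegInvGlue (1 - u ^ 2) : ℝ) : ℂ)) with hN
  set H : ℝ := 2 * (∑ m ∈ Finset.Icc 1 M, ∑ n ∈ Finset.Icc 1 (M / m),
      ((ArithmeticFunction.vonMangoldt n : ℝ) : ℂ) / (Real.sqrt n : ℂ) * a (n * m) *
        conj (a m)).re with hH
  set L : ℝ := ∑ m ∈ Finset.Icc 1 M, ‖a m‖ ^ 2 with hL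
  set P : ℝ := 2 * (weilMellin φε 0 * conj (weilMellin φε 1) *
      ((∑ m ∈ Finset.Icc 1 M, a m * ((Real.sqrt (m : ℝ) : ℝ) : ℂ)⁻¹) *
        conj (∑ m ∈ Finset.Icc 1 M, a m * ((Real.sqrt (m : ℝ) : ℝ) : ℂ)))).re with hP
  set D : ℝ → ℂ := fun t : ℝ => ∑ m ∈ Finset.Icc 1 M, a m * cexp (t * I * (Real.log (m : ℝ) : ℂ)) with hD
  set J : ℝ := ∫ t : ℝ, ‖weilMellin φε (1 / 2 + t * I)‖ ^ 2 * ‖D t‖ ^ 2 *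
      (Complex.digamma (1 / 4 + t / 2 * I)).re with hJ
  -- the comb is a Weil test
  have hgW : IsWeilTest g :=
    Summit.RiemannHypothesis.RiemannHypothesis.Theorems.weilComb_shapeComb_isWeilTest ε M a
  -- Step 1: exact window identity and polar identity
  have h1 := weilQuadratic_comb_re_exactWindow ε hε M a hM hw
  have h2 := weilPolarTerm_comb_re ε hε M a
  -- Step 2: the archimedean term of `g ⋆ g̃`
  have h3 : (weilArchTerm (weilConv g (weilReflect g))).re =
      1 / (2 * Real.pi) * (∫ t : ℝ, ‖weilMellin g (1 / 2 + t * I)‖ ^ 2 *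
        (Complex.digamma (1 / 4 + t / 2 * I)).re) - weilNorm2Sq g * Real.log Real.pi := by
    unfold weilArchTerm
    rw [weilArchIntegral_weilConv_weilReflect hgW, weilConv_weilReflect_apply_zero]
    have e : ((1 / (2 * Real.pi) : ℂ) * ((∫ t : ℝ, ‖weilMellin g (1 / 2 + t * I)‖ ^ 2 *
          (Complex.digamma (1 / 4 + t / 2 * I)).re : ℝ) : ℂ) -
          ((∫ t : ℝ, ‖g t‖ ^ 2 : ℝ) : ℂ) * (Real.log Real.pi : ℂ)) =
        ((1 / (2 * Real.pi) * (∫ t : ℝ, ‖weilMellin g (1 / 2 + t * I)‖ ^ 2 *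
          (Complex.digamma (1 / 4 + t / 2 * I)).re) - weilNorm2Sq g * Real.log Real.pi : ℝ) : ℂ) := by
      unfold weilNorm2Sq
      push_cast
      ring
    rw [e, Complex.ofReal_re]
  -- Step 3: `|ĝ(1/2+it)|² = |φ̂_ε(1/2+it)|² |D_a(t)|²` under the integral
  have h4 : (∫ t : ℝ, ‖weilMellin g (1 / 2 + t * I)‖ ^ 2 * (Complex.digamma (1 / 4 + t / 2 * I)).re) =
      J := by
    rw [hJ]
    congr 1
    funext t
    rw [hg, stub_windowMellin ε hε M a t, norm_mul, mul_pow]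
    ring
  -- Step 4: the window norm identity
  have h5 : weilNorm2Sq g = ε⁻¹ * N * L := by
    rw [hg, hN, hL]
    exact stub_windowNorm ε hε M a hw
  rw [h1, h2, h3, h4, h5]
  ring

/-- **The normal-form inequality IS the window cell.** For `0 < ε`, `1 ≤ M`, `2ε(M+1) ≤ 1` and every `a`:
`ε⁻¹‖φ₀‖₂² (H(a) + log π ‖a‖²) ≤ P + J/2π  ↔  0 ≤ Re Q(g)`. [folklore] -/
theorem window_normalForm_iff_nonneg : ∀ ε : ℝ, 0 < ε → ∀ (M : ℕ) (a : ℕ → ℂ), 1 ≤ M →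
    2 * ε * ((M : ℝ) + 1) ≤ 1 →
    ((ε⁻¹ * weilNorm2Sq (fun u : ℝ => ((expNegInvGlue (1 - u ^ 2) : ℝ) : ℂ)) *
        (2 * (∑ m ∈ Finset.Icc 1 M, ∑ n ∈ Finset.Icc 1 (M / m),
            ((ArithmeticFunction.vonMangoldt n : ℝ) : ℂ) / (Real.sqrt n : ℂ) * a (n * m) *
              conj (a m)).re
          + Real.log Real.pi * ∑ m ∈ Finset.Icc 1 M, ‖a m‖ ^ 2) ≤
      2 * (weilMellin (fun t : ℝ => (ε : ℂ)⁻¹ * ((expNegInvGlue (1 - (t / ε) ^ 2) : ℝ) : ℂ)) 0 *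
            conj (weilMellin (fun t : ℝ => (ε : ℂ)⁻¹ * ((expNegInvGlue (1 - (t / ε) ^ 2) : ℝ) : ℂ)) 1) *
          ((∑ m ∈ Finset.Icc 1 M, a m * ((Real.sqrt (m : ℝ) : ℝ) : ℂ)⁻¹) *
            conj (∑ m ∈ Finset.Icc 1 M, a m * ((Real.sqrt (m : ℝ) : ℝ) : ℂ)))).re
      + 1 / (2 * Real.pi) * ∫ t : ℝ,
          ‖weilMellin (fun t : ℝ => (ε : ℂ)⁻¹ * ((expNegInvGlue (1 - (t / ε) ^ 2) : ℝ) : ℂ))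
              (1 / 2 + t * I)‖ ^ 2 *
            ‖∑ m ∈ Finset.Icc 1 M, a m * cexp (t * I * (Real.log (m : ℝ) : ℂ))‖ ^ 2 *
            (Complex.digamma (1 / 4 + t / 2 * I)).re) ↔
    0 ≤ (weilQuadratic (fun x : ℝ => ∑ m ∈ Finset.Icc 1 M,
        a m * ((ε : ℂ)⁻¹ * ((expNegInvGlue (1 - ((x - Real.log (m : ℝ)) / ε) ^ 2) : ℝ) : ℂ)))).re) := by
  intro ε hε M a hM hw
  rw [weilQuadratic_comb_re_window_normalForm ε hε M a hM hw]
  constructor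
  · intro h
    linarith
  · intro h
    linarith

/-! ## Level monotonicity: the window is its top cells -/

/-- A window cell with `M = 0` is trivial: the comb is `0` and `Q(0) = 0`. [folklore] -/
theorem window_cell_zero (ε : ℝ) (a : ℕ → ℂ) :
    0 ≤ (weilQuadratic (fun x : ℝ => ∑ m ∈ Finset.Icc 1 0,
        a m * ((ε : ℂ)⁻¹ * ((expNegInvGlue (1 - ((x - Real.log (m : ℝ)) / ε) ^ 2) : ℝ) : ℂ)))).re := by
  have h0 : (fun x : ℝ => ∑ m ∈ Finset.Icc 1 0,
      a m * ((ε : ℂ)⁻¹ * ((expNegInvGlue (1 - ((x - Real.log (m : ℝ)) / ε) ^ 2) : ℝ) : ℂ))) = 0 := by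
    funext x
    simp
  rw [h0, weilQuadratic_zero]
  simp

/-- **Level monotonicity inside the window.** Positivity of the cell `(ε, M')` for all coefficient vectors gives every
cell `(ε, M)` with `M ≤ M'` (extend `a` by zero: the comb is unchanged, `weilComb_shapeComb_extend`). [folklore] -/
theorem window_cell_mono {ε : ℝ} {M M' : ℕ} (hMM' : M ≤ M')
    (h : ∀ a : ℕ → ℂ, 0 ≤ (weilQuadratic (fun x : ℝ => ∑ m ∈ Finset.Icc 1 M',
        a m * ((ε : ℂ)⁻¹ * ((expNegInvGlue (1 - ((x - Real.log (m : ℝ)) / ε) ^ 2) : ℝ) : ℂ)))).re)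
    (a : ℕ → ℂ) :
    0 ≤ (weilQuadratic (fun x : ℝ => ∑ m ∈ Finset.Icc 1 M,
        a m * ((ε : ℂ)⁻¹ * ((expNegInvGlue (1 - ((x - Real.log (m : ℝ)) / ε) ^ 2) : ℝ) : ℂ)))).re := by
  have key := h (fun m => if m ≤ M then a m else 0)
  rwa [Summit.RiemannHypothesis.RiemannHypothesis.Theorems.weilComb_shapeComb_extend hMM'] at key

/-- **The top cell of a width.** For `0 < ε` and a window cell `M ≥ 1`, `2ε(M+1) ≤ 1` there is a top cell `M' ≥ M` of
the same width: `2ε(M'+1) ≤ 1 < 2ε(M'+2)` (namely `M' = ⌊1/(2ε)⌋ − 1`). [folklore] -/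
theorem exists_topCell {ε : ℝ} (hε : 0 < ε) {M : ℕ} (hM : 1 ≤ M) (hw : 2 * ε * ((M : ℝ) + 1) ≤ 1) :
    ∃ M' : ℕ, M ≤ M' ∧ 2 * ε * ((M' : ℝ) + 1) ≤ 1 ∧ 1 < 2 * ε * ((M' : ℝ) + 2) := by
  -- `K = ⌊1/(2ε)⌋ ≥ M + 1 ≥ 2`, `M' = K - 1`
  set K : ℕ := ⌊1 / (2 * ε)⌋₊ with hK
  have h2ε : 0 < 2 * ε := by positivity
  have hMK : M + 1 ≤ K := by
    rw [hK]
    refine Nat.le_floor ?_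
    rw [le_div_iff₀ h2ε]
    push_cast
    linarith
  refine ⟨K - 1, by omega, ?_, ?_⟩
  · have hKle : (K : ℝ) ≤ 1 / (2 * ε) := Nat.floor_le (by positivity)
    have hK1 : 1 ≤ K := by omega
    have e : ((K - 1 : ℕ) : ℝ) + 1 = K := by
      rw [Nat.cast_sub hK1]
      push_cast
      ring
    rw [e]
    rw [le_div_iff₀ h2ε] at hKle
    linarith
  · have hKlt : 1 / (2 * ε) < (K : ℝ) + 1 := Nat.lt_floor_add_one _
    have hK1 : 1 ≤ K := by omega
    have e : ((K - 1 : ℕ) : ℝ) + 2 = K + 1 := by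
      rw [Nat.cast_sub hK1]
      push_cast
      ring
    rw [e]
    rw [div_lt_iff₀ h2ε] at hKlt
    linarith

/-- **Theorem B from its top cells.** If every TOP cell (`M ≥ 1`, `2ε(M+1) ≤ 1 < 2ε(M+2)`) is positive for all
coefficient vectors, then the whole exact window `2ε(M+1) ≤ 1` is (level monotonicity; `M = 0` is trivial). All top cells
satisfy `1/2 − 2ε < εM ≤ 1/2 − ε`. [folklore] -/
theorem window_of_topCells
    (htop : ∀ ε : ℝ, 0 < ε → ∀ (M : ℕ) (a : ℕ → ℂ), 1 ≤ M → 2 * ε * ((M : ℝ) + 1) ≤ 1 →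
      1 < 2 * ε * ((M : ℝ) + 2) →
      0 ≤ (weilQuadratic (fun x : ℝ => ∑ m ∈ Finset.Icc 1 M,
        a m * ((ε : ℂ)⁻¹ * ((expNegInvGlue (1 - ((x - Real.log (m : ℝ)) / ε) ^ 2) : ℝ) : ℂ)))).re) :
    ∀ ε : ℝ, 0 < ε → ∀ (M : ℕ) (a : ℕ → ℂ), 2 * ε * ((M : ℝ) + 1) ≤ 1 →
      0 ≤ (weilQuadratic (fun x : ℝ => ∑ m ∈ Finset.Icc 1 M,
        a m * ((ε : ℂ)⁻¹ * ((expNegInvGlue (1 - ((x - Real.log (m : ℝ)) / ε) ^ 2) : ℝ) : ℂ)))).re := by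
  intro ε hε M a hw
  rcases Nat.eq_zero_or_pos M with hM0 | hMpos
  · subst hM0
    exact window_cell_zero ε a
  obtain ⟨M', hMM', hw', htop'⟩ := exists_topCell hε hMpos hw
  have hM' : 1 ≤ M' := le_trans hMpos hMM'
  exact window_cell_mono hMM' (fun b => htop ε hε M' b hM' hw' htop') a

/-- Top cells lie in the band `1/40 < εM` (indeed `εM > max(1/2 − 2ε, ε) ≥ 1/6`). [folklore] -/
theorem topCell_band {ε : ℝ} {M : ℕ} (hM : 1 ≤ M) (htop : 1 < 2 * ε * ((M : ℝ) + 2)) :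
    1 / 40 < ε * M := by
  have hMr : (1 : ℝ) ≤ (M : ℝ) := by exact_mod_cast hM
  by_cases hε' : ε ≤ 19 / 80
  · nlinarith
  · push Not at hε'
    nlinarith

/-! ## The residual stub is the whole of Theorem B -/

/-- **`stub_windowCore` ⟺ band positivity.** The registered stub (normal form on the band `1/40 < εM`, `2ε(M+1) ≤ 1`,
`M ≥ 1`) is equivalent to `0 ≤ Re Q(g)` on the same cells. [folklore] -/
theorem stub_windowCore_iff_band :
    (∀ ε : ℝ, 0 < ε → ∀ (M : ℕ) (a : ℕ → ℂ), 1 ≤ M → 1 / 40 < ε * M →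
      2 * ε * ((M : ℝ) + 1) ≤ 1 →
      ε⁻¹ * weilNorm2Sq (fun u : ℝ => ((expNegInvGlue (1 - u ^ 2) : ℝ) : ℂ)) *
          (2 * (∑ m ∈ Finset.Icc 1 M, ∑ n ∈ Finset.Icc 1 (M / m),
              ((ArithmeticFunction.vonMangoldt n : ℝ) : ℂ) / (Real.sqrt n : ℂ) * a (n * m) *
                conj (a m)).re
            + Real.log Real.pi * ∑ m ∈ Finset.Icc 1 M, ‖a m‖ ^ 2) ≤
        2 * (weilMellin (fun t : ℝ => (ε : ℂ)⁻¹ * ((expNegInvGlue (1 - (t / ε) ^ 2) : ℝ) : ℂ)) 0 *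
              conj (weilMellin (fun t : ℝ => (ε : ℂ)⁻¹ * ((expNegInvGlue (1 - (t / ε) ^ 2) : ℝ) : ℂ)) 1) *
            ((∑ m ∈ Finset.Icc 1 M, a m * ((Real.sqrt (m : ℝ) : ℝ) : ℂ)⁻¹) *
              conj (∑ m ∈ Finset.Icc 1 M, a m * ((Real.sqrt (m : ℝ) : ℝ) : ℂ)))).re
        + 1 / (2 * Real.pi) * ∫ t : ℝ,
            ‖weilMellin (fun t : ℝ => (ε : ℂ)⁻¹ * ((expNegInvGlue (1 - (t / ε) ^ 2) : ℝ) : ℂ))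
                (1 / 2 + t * I)‖ ^ 2 *
              ‖∑ m ∈ Finset.Icc 1 M, a m * cexp (t * I * (Real.log (m : ℝ) : ℂ))‖ ^ 2 *
              (Complex.digamma (1 / 4 + t / 2 * I)).re) ↔
    (∀ ε : ℝ, 0 < ε → ∀ (M : ℕ) (a : ℕ → ℂ), 1 ≤ M → 1 / 40 < ε * M →
      2 * ε * ((M : ℝ) + 1) ≤ 1 →
      0 ≤ (weilQuadratic (fun x : ℝ => ∑ m ∈ Finset.Icc 1 M,
        a m * ((ε : ℂ)⁻¹ * ((expNegInvGlue (1 - ((x - Real.log (m : ℝ)) / ε) ^ 2) : ℝ) : ℂ)))).re) := by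
  constructor
  · intro h ε hε M a hM hlam hw
    exact (window_normalForm_iff_nonneg ε hε M a hM hw).1 (h ε hε M a hM hlam hw)
  · intro h ε hε M a hM hlam hw
    exact (window_normalForm_iff_nonneg ε hε M a hM hw).2 (h ε hε M a hM hlam hw)

/-- **Theorem B ⟺ `stub_windowCore`.** Exact-window comb positivity (`∀ ε > 0, M, a, 2ε(M+1) ≤ 1 → 0 ≤ Re Q(g)`,
the route's Theorem B, all levels `M`) is EQUIVALENT to the registered residual stub on the band `1/40 < εM`: the band
contains every top cell, and the top cells give the window by level monotonicity.  In particular the effective windows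
(`εM ≤ 1/128`, p103822; `εM ≤ 1/40`, skeleton v7) are corollaries of the stub. [folklore] -/
theorem window_iff_stub_windowCore :
    (∀ ε : ℝ, 0 < ε → ∀ (M : ℕ) (a : ℕ → ℂ), 2 * ε * ((M : ℝ) + 1) ≤ 1 →
      0 ≤ (weilQuadratic (fun x : ℝ => ∑ m ∈ Finset.Icc 1 M,
        a m * ((ε : ℂ)⁻¹ * ((expNegInvGlue (1 - ((x - Real.log (m : ℝ)) / ε) ^ 2) : ℝ) : ℂ)))).re) ↔
    (∀ ε : ℝ, 0 < ε → ∀ (M : ℕ) (a : ℕ → ℂ), 1 ≤ M → 1 / 40 < ε * M →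
      2 * ε * ((M : ℝ) + 1) ≤ 1 →
      ε⁻¹ * weilNorm2Sq (fun u : ℝ => ((expNegInvGlue (1 - u ^ 2) : ℝ) : ℂ)) *
          (2 * (∑ m ∈ Finset.Icc 1 M, ∑ n ∈ Finset.Icc 1 (M / m),
              ((ArithmeticFunction.vonMangoldt n : ℝ) : ℂ) / (Real.sqrt n : ℂ) * a (n * m) *
                conj (a m)).re
            + Real.log Real.pi * ∑ m ∈ Finset.Icc 1 M, ‖a m‖ ^ 2) ≤
        2 * (weilMellin (fun t : ℝ => (ε : ℂ)⁻¹ * ((expNegInvGlue (1 - (t / ε) ^ 2) : ℝ) : ℂ)) 0 *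
              conj (weilMellin (fun t : ℝ => (ε : ℂ)⁻¹ * ((expNegInvGlue (1 - (t / ε) ^ 2) : ℝ) : ℂ)) 1) *
            ((∑ m ∈ Finset.Icc 1 M, a m * ((Real.sqrt (m : ℝ) : ℝ) : ℂ)⁻¹) *
              conj (∑ m ∈ Finset.Icc 1 M, a m * ((Real.sqrt (m : ℝ) : ℝ) : ℂ)))).re
        + 1 / (2 * Real.pi) * ∫ t : ℝ,
            ‖weilMellin (fun t : ℝ => (ε : ℂ)⁻¹ * ((expNegInvGlue (1 - (t / ε) ^ 2) : ℝ) : ℂ))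
                (1 / 2 + t * I)‖ ^ 2 *
              ‖∑ m ∈ Finset.Icc 1 M, a m * cexp (t * I * (Real.log (m : ℝ) : ℂ))‖ ^ 2 *
              (Complex.digamma (1 / 4 + t / 2 * I)).re) := by
  rw [stub_windowCore_iff_band]
  constructor
  · intro h ε hε M a _ _ hw
    exact h ε hε M a hw
  · intro h
    refine window_of_topCells fun ε hε M a hM hw htop => ?_
    exact h ε hε M a hM (topCell_band hM htop) hw

/-- **`stub_windowCore` ⟺ positivity on the top cells** (`M ≥ 1`, `2ε(M+1) ≤ 1 < 2ε(M+2)`, so `1/2 − 2ε < εM ≤ 1/2 − ε`):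
the whole content of the residual stub sits on the curve `εM → 1/2`. [folklore] -/
theorem stub_windowCore_iff_topCells :
    (∀ ε : ℝ, 0 < ε → ∀ (M : ℕ) (a : ℕ → ℂ), 1 ≤ M → 1 / 40 < ε * M →
      2 * ε * ((M : ℝ) + 1) ≤ 1 →
      ε⁻¹ * weilNorm2Sq (fun u : ℝ => ((expNegInvGlue (1 - u ^ 2) : ℝ) : ℂ)) *
          (2 * (∑ m ∈ Finset.Icc 1 M, ∑ n ∈ Finset.Icc 1 (M / m),
              ((ArithmeticFunction.vonMangoldt n : ℝ) : ℂ) / (Real.sqrt n : ℂ) * a (n * m) *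
                conj (a m)).re
            + Real.log Real.pi * ∑ m ∈ Finset.Icc 1 M, ‖a m‖ ^ 2) ≤
        2 * (weilMellin (fun t : ℝ => (ε : ℂ)⁻¹ * ((expNegInvGlue (1 - (t / ε) ^ 2) : ℝ) : ℂ)) 0 *
              conj (weilMellin (fun t : ℝ => (ε : ℂ)⁻¹ * ((expNegInvGlue (1 - (t / ε) ^ 2) : ℝ) : ℂ)) 1) *
            ((∑ m ∈ Finset.Icc 1 M, a m * ((Real.sqrt (m : ℝ) : ℝ) : ℂ)⁻¹) *
              conj (∑ m ∈ Finset.Icc 1 M, a m * ((Real.sqrt (m : ℝ) : ℝ) : ℂ)))).re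
        + 1 / (2 * Real.pi) * ∫ t : ℝ,
            ‖weilMellin (fun t : ℝ => (ε : ℂ)⁻¹ * ((expNegInvGlue (1 - (t / ε) ^ 2) : ℝ) : ℂ))
                (1 / 2 + t * I)‖ ^ 2 *
              ‖∑ m ∈ Finset.Icc 1 M, a m * cexp (t * I * (Real.log (m : ℝ) : ℂ))‖ ^ 2 *
              (Complex.digamma (1 / 4 + t / 2 * I)).re) ↔
    (∀ ε : ℝ, 0 < ε → ∀ (M : ℕ) (a : ℕ → ℂ), 1 ≤ M → 2 * ε * ((M : ℝ) + 1) ≤ 1 →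
      1 < 2 * ε * ((M : ℝ) + 2) →
      0 ≤ (weilQuadratic (fun x : ℝ => ∑ m ∈ Finset.Icc 1 M,
        a m * ((ε : ℂ)⁻¹ * ((expNegInvGlue (1 - ((x - Real.log (m : ℝ)) / ε) ^ 2) : ℝ) : ℂ)))).re) := by
  rw [← window_iff_stub_windowCore]
  constructor
  · intro h ε hε M a _ hw _
    exact h ε hε M a hw
  · intro h
    exact window_of_topCells h

end Summit.RiemannHypothesis.RiemannHypothesis.Theorems.WeilCombBohrFejer

end
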